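import Mathlib
import Literature.Analysis.PDE.DivFormLiouville
import Literature.Analysis.PDE.DivForm.Harnack
import HarnessLib

/-!
# Liouville's theorem for `div(a∇u) = 0` with bounded measurable coefficients, in every dimension (Jost Thm 14.2.3; Moser 1961) — `divFormLiouville` proved inside Literature (re-homed proofs)

**Liouville's theorem for `div(a∇u) = 0`** (Jost, *Partial Differential Equations*, Theorem 14.2.3; Moser 1961, corollary of Theorem 1):
every bounded entire `C¹` weak solution of a divergence-form equation with bounded measurable uniformly elliptic symmetric coefficients is
constant, IN EVERY DIMENSION `n` (`LiouvilleAll.liouville_all`): for `n ≥ 3` from Moser's Harnack inequality (`DivForm/Harnack.lean`) by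
scaling to all balls (Part 1, `harnack_ball`, `liouville_of_three_le`); for `n ≤ 2` by DESCENT — a solution on `ℝⁿ` lifts to one on
`ℝⁿ⁺¹` with the coefficient field `ã = a ⊕ 1` (Part 2: the lift `proj`/`emb`/`liftCoeff` and its ellipticity; Part 3: the lifted weak
equation by Fubini, `liouville_descent`) — RE-HOMED into `Literature/` by the Hodge foundations lane (`lit-hodgefound`, seat p20, generation 36)
from the cell ns-poloidal (route `PoloidalWindowDoor`, crux K2, seat ns-poloidal-K2-p3 g2): verbatim ports, in dependency order and each with
its original module docstring, of the modules `Summits/NavierStokesRegularity/NavierStokesRegularity/Theorems/PoloidalWindowDoorPoloidalWindowRigidityDivForm{LiouvilleHigh,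
Descent, LiouvilleAll}.lean`, namespace `Summit.NavierStokesRegularity.NavierStokesRegularity.Theorems.PoloidalWindowDoorPoloidalWindowRigidityDivForm<Step>` re-rooted as
`Literature.Analysis.PDE.DivForm.<Step>` (this file's path namespace + the source's step name).  SETTING throughout (the rendering of the
Literature named fact `Literature.Analysis.PDE.divFormLiouville`, Jost Thm 14.2.3 / Moser 1961): a measurable symmetric coefficient field
`a : ℝⁿ → Matₙ(ℝ)` with `λ|ξ|² ≤ ξ·a(y)ξ` and `|aᵢⱼ| ≤ Λ`, and `C¹` functions `u` satisfying the weak equation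
`∫ Σᵢⱼ aᵢⱼ ∂ᵢu ∂ⱼη = 0` for all `C¹` compactly supported `η` (so `u ∈ W^{1,2}_loc`; the `C¹` rendering is the fact's, see its TODO).
Theorems only unless said; no named fact; imports Mathlib/Literature only (the tree's `Literature/Analysis/FunctionSpaces/{SmoothCutoff,
MoserIteration, BMO, BMOJohnNirenberg(+Lp), PoincareWirtingerConvex, BombieriGiustiLemma}`); every declaration carries the citation of the
printed step it formalises (the originals' `[folklore]` helpers are re-tagged with the theorem they serve).  The Summits originals stay in
place (transitional duplication; twins = same short names under the Summits namespaces).  Nothing here is specific to Navier–Stokes, and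
nothing about Navier–Stokes regularity is claimed.
Definitions kept from the source (with bodies, verbatim): `Descent.proj`, `Descent.emb`, `Descent.liftCoeff` (drop / append the last
coordinate; the lifted coefficient matrix).  Part 4 is the DISCHARGE `Literature.Analysis.PDE.DivForm.divFormLiouville_holds : divFormLiouville`
of the Literature named fact `Literature.Analysis.PDE.divFormLiouville` (`DivFormLiouville.lean`); the fact's canonical name
`Literature.Analysis.PDE.divFormLiouville_holds` is already declared — Summits-side, by the source module (so the gate's registry credits the
fact) — and cannot be re-declared here; this file makes the proof importable from `Literature/`.
-/

noncomputable section

/-!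
## Part 1 — port of `Summits/NavierStokesRegularity/NavierStokesRegularity/Theorems/PoloidalWindowDoorPoloidalWindowRigidityDivFormLiouvilleHigh.lean`

# Route `PoloidalWindowDoor`, crux K2 (stmt-NavierStokesRegularity-19708) — task H5, step M4b: scaling, HARNACK ON ALL BALLS,
# and the LIOUVILLE THEOREM for `div(a∇u) = 0` in dimension `n ≥ 3` (towards `divFormLiouville_holds`)

Seat ns-poloidal-K2-p3 g2 (`ledger fact claim` #1 on `Literature.Analysis.PDE.divFormLiouville`).  Moser 1961, Thm 1 and its
Liouville corollary (Jost, *PDE*, Thm 14.2.3), `n ≥ 3`: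

* `weak_comp_affine` — the class of entire `C¹` weak solutions is invariant under `w ↦ w(x₀ + R·)` (coefficients
  `a(x₀ + R·)`, same ellipticity constants);
* `harnack_ball` — `w(x) ≤ C_H w(y)` for `x, y ∈ B̄(x₀,R)`, every `x₀`, `R > 0`, `C_H = C_H(n,λ,Λ)` (from M4a by scaling);
* `liouville_of_three_le` — a bounded entire `C¹` weak solution is constant (`n ≥ 3`): apply Harnack to
  `w_ε = (u − inf u + ε)/ε ≥ 1` and let `R → ∞`, `ε → 0`.

WHAT THIS IS NOT: the dimensions `n ≤ 2` (M4c, by lifting to `ℝ^{n+3}`) and the Literature-side discharge file remain.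
-/

section Part1

noncomputable section

open _root_.MeasureTheory _root_.Set _root_.Function _root_.Filter _root_.Topology _root_.Metric _root_.Module
open scoped _root_.Matrix _root_.ENNReal _root_.NNReal

namespace Literature.Analysis.PDE.DivForm.LiouvilleHigh

open Literature.Analysis.PDE.DivForm.Harnack

variable {n : ℕ} {a : EuclideanSpace ℝ (Fin n) → Matrix (Fin n) (Fin n) ℝ} {lam Λ : ℝ}
  {w : EuclideanSpace ℝ (Fin n) → ℝ}

/-! ### Scaling and translation -/

/-- **Affine invariance of the class.**  If `w` is an entire `C¹` weak solution for the coefficients `a`, then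
`y ↦ w(x₀ + R y)` (`R ≠ 0`) is one for `y ↦ a(x₀ + R y)`.
[cite: Jost2013PDE, Theorem 14.2.3 p.370 (Liouville; scaling of Moser's Harnack inequality)] -/
theorem weak_comp_affine (hw : ContDiff ℝ 1 w)
    (hweak : ∀ η : EuclideanSpace ℝ (Fin n) → ℝ, ContDiff ℝ 1 η → HasCompactSupport η →
      ∫ y, ∑ i, ∑ j, a y i j * fderiv ℝ w y (EuclideanSpace.single i 1) *
        fderiv ℝ η y (EuclideanSpace.single j 1) = 0)
    (x₀ : EuclideanSpace ℝ (Fin n)) {R : ℝ} (hR : R ≠ 0) :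
    ∀ η : EuclideanSpace ℝ (Fin n) → ℝ, ContDiff ℝ 1 η → HasCompactSupport η →
      ∫ y, ∑ i, ∑ j, a (x₀ + R • y) i j * fderiv ℝ (fun y => w (x₀ + R • y)) y (EuclideanSpace.single i 1) *
        fderiv ℝ η y (EuclideanSpace.single j 1) = 0 := by
  intro η hη hηc
  -- the affine map and its inverse
  set T : EuclideanSpace ℝ (Fin n) → EuclideanSpace ℝ (Fin n) := fun y => x₀ + R • y with hT
  set S : EuclideanSpace ℝ (Fin n) → EuclideanSpace ℝ (Fin n) := fun z => R⁻¹ • (-x₀ + z) with hS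
  have hST : ∀ y, S (T y) = y := fun y => by
    simp only [hS, hT, neg_add_cancel_left, smul_smul, inv_mul_cancel₀ hR, one_smul]
  have hTd : ∀ y, HasFDerivAt T (R • ContinuousLinearMap.id ℝ _) y := fun y => by
    have h := ((ContinuousLinearMap.id ℝ (EuclideanSpace ℝ (Fin n))).hasFDerivAt (x := y)).const_smul R
    simpa [hT] using h.const_add x₀
  -- the transported test function `η̃ = η ∘ S`
  set ηt : EuclideanSpace ℝ (Fin n) → ℝ := fun z => η (S z) with hηt
  have hSC : ContDiff ℝ 1 S := (contDiff_const.add contDiff_id).const_smul R⁻¹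
  have hTC : ContDiff ℝ 1 T := contDiff_const.add (contDiff_id.const_smul R)
  have hηtC : ContDiff ℝ 1 ηt := hη.comp hSC
  have hηtc : HasCompactSupport ηt := by
    have hφ : HasCompactSupport (η ∘ ((Homeomorph.addLeft (-x₀)).trans (Homeomorph.smulOfNeZero R⁻¹ (inv_ne_zero hR)))) :=
      hηc.comp_homeomorph _
    have heq : ηt = η ∘ ((Homeomorph.addLeft (-x₀)).trans (Homeomorph.smulOfNeZero R⁻¹ (inv_ne_zero hR))) := by
      funext z
      simp [hηt, hS, Homeomorph.trans_apply]
    rw [heq]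
    exact hφ
  -- chain rules: `∂ᵢ(w ∘ T)(y) = R ∂ᵢw(T y)`, `∂ⱼη(y) = ∂ⱼ(η̃ ∘ T)(y) = R ∂ⱼη̃(T y)`
  have hdw : ∀ y i, fderiv ℝ (fun y => w (x₀ + R • y)) y (EuclideanSpace.single i 1) =
      R * fderiv ℝ w (T y) (EuclideanSpace.single i 1) := by
    intro y i
    have h := (((hw.differentiable one_ne_zero) (T y)).hasFDerivAt).comp y (hTd y)
    rw [show (fun y => w (x₀ + R • y)) = w ∘ T from rfl, h.fderiv]
    simp
  have hdη : ∀ y j, fderiv ℝ η y (EuclideanSpace.single j 1) = R * fderiv ℝ ηt (T y) (EuclideanSpace.single j 1) := by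
    intro y j
    have hηeq : η = ηt ∘ T := by funext y'; simp [hηt, hST]
    have h := (((hηtC.differentiable one_ne_zero) (T y)).hasFDerivAt).comp y (hTd y)
    rw [hηeq, h.fderiv]
    simp
  -- the integrand is `R² F(T y)` with `F` the integrand of the weak form for `η̃`
  set F : EuclideanSpace ℝ (Fin n) → ℝ := fun z => ∑ i, ∑ j, a z i j * fderiv ℝ w z (EuclideanSpace.single i 1) *
    fderiv ℝ ηt z (EuclideanSpace.single j 1) with hF
  have hpt : ∀ y, ∑ i, ∑ j, a (x₀ + R • y) i j * fderiv ℝ (fun y => w (x₀ + R • y)) y (EuclideanSpace.single i 1) *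
      fderiv ℝ η y (EuclideanSpace.single j 1) = R ^ 2 * F (T y) := by
    intro y
    simp only [hF, hdw, hdη, Finset.mul_sum]
    refine Finset.sum_congr rfl fun i _ => Finset.sum_congr rfl fun j _ => ?_
    simp only [hT]; ring
  simp_rw [hpt]
  rw [integral_const_mul]
  have hF0 : ∫ z, F z = 0 := hweak ηt hηtC hηtc
  have hcomp : ∫ y, F (T y) = |(R ^ finrank ℝ (EuclideanSpace ℝ (Fin n)))⁻¹| * ∫ z, F z := by
    have h1 : ∫ y, F (T y) = ∫ y, (fun z => F (x₀ + z)) (R • y) := by simp only [hT]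
    have h2 : ∫ y, (fun z => F (x₀ + z)) (R • y) =
        |(R ^ finrank ℝ (EuclideanSpace ℝ (Fin n)))⁻¹| • ∫ z, (fun z => F (x₀ + z)) z :=
      by
        have h := Measure.integral_comp_smul (μ := (volume : Measure (EuclideanSpace ℝ (Fin n))))
          (fun z => F (x₀ + z)) R
        convert h using 3
    have h3 : ∫ z, (fun z => F (x₀ + z)) z = ∫ z, F z := integral_add_left_eq_self F x₀
    rw [h1, h2, h3, smul_eq_mul]
  rw [hcomp, hF0, mul_zero, mul_zero]

/-! ### Harnack on every ball -/

/-- **MOSER'S HARNACK INEQUALITY** (Moser 1961, Thm 1), `n ≥ 3`: there is `C_H = C_H(n,λ,Λ) ≥ 0` such that every entire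
`C¹` weak solution `w ≥ 1` of `div(a∇w) = 0` satisfies `w(x) ≤ C_H w(y)` for all `x, y ∈ B̄(x₀,R)`, every `x₀`, `R > 0`.
[cite: Jost2013PDE, Theorem 14.2.3 p.370 (Liouville; scaling of Moser's Harnack inequality)] -/
theorem harnack_ball (hn : 3 ≤ n) {lam : ℝ} (hlam : 0 < lam) (Λ : ℝ) :
    ∃ C_H : ℝ, 0 ≤ C_H ∧ ∀ (a : EuclideanSpace ℝ (Fin n) → Matrix (Fin n) (Fin n) ℝ),
      (∀ i j, Measurable fun y => a y i j) → (∀ y, (a y).IsSymm) →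
      (∀ y (ξ : Fin n → ℝ), lam * (ξ ⬝ᵥ ξ) ≤ ξ ⬝ᵥ (a y *ᵥ ξ)) → (∀ y i j, |a y i j| ≤ Λ) →
      ∀ (w : EuclideanSpace ℝ (Fin n) → ℝ), ContDiff ℝ 1 w → (∀ y, 1 ≤ w y) →
        (∀ η : EuclideanSpace ℝ (Fin n) → ℝ, ContDiff ℝ 1 η → HasCompactSupport η →
          ∫ y, ∑ i, ∑ j, a y i j * fderiv ℝ w y (EuclideanSpace.single i 1) *
            fderiv ℝ η y (EuclideanSpace.single j 1) = 0) →
        ∀ (x₀ : EuclideanSpace ℝ (Fin n)) (R : ℝ), 0 < R →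
          ∀ x ∈ closedBall x₀ R, ∀ y ∈ closedBall x₀ R, w x ≤ C_H * w y := by
  obtain ⟨C_H, hC0, hH⟩ := harnack_unit hn hlam Λ
  refine ⟨C_H, hC0, fun a hmeas hsymm hell hbd w hw hw1 hweak x₀ R hR x hx y hy => ?_⟩
  have hT : Continuous fun y : EuclideanSpace ℝ (Fin n) => x₀ + R • y := continuous_const.add (continuous_id.const_smul R)
  have hTC : ContDiff ℝ 1 fun y : EuclideanSpace ℝ (Fin n) => x₀ + R • y := contDiff_const.add (contDiff_id.const_smul R)
  have h := hH (fun y => a (x₀ + R • y)) (fun i j => (hmeas i j).comp hT.measurable) (fun y => hsymm _)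
    (fun y ξ => hell _ ξ) (fun y i j => hbd _ i j) (fun y => w (x₀ + R • y)) (hw.comp hTC) (fun y => hw1 _)
    (weak_comp_affine hw hweak x₀ hR.ne')
  -- pull back the two points
  have hmem : ∀ z ∈ closedBall x₀ R, R⁻¹ • (z - x₀) ∈ closedBall (0 : EuclideanSpace ℝ (Fin n)) 1 := by
    intro z hz
    rw [mem_closedBall, dist_zero_right, norm_smul, norm_inv, Real.norm_eq_abs, abs_of_pos hR]
    rw [mem_closedBall, dist_eq_norm] at hz
    calc R⁻¹ * ‖z - x₀‖ ≤ R⁻¹ * R := mul_le_mul_of_nonneg_left hz (inv_nonneg.2 hR.le)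
      _ = 1 := inv_mul_cancel₀ hR.ne'
  have hback : ∀ z, x₀ + R • (R⁻¹ • (z - x₀)) = z := fun z => by
    rw [smul_smul, mul_inv_cancel₀ hR.ne', one_smul, add_sub_cancel]
  have h' := h _ (hmem x hx) _ (hmem y hy)
  simp only [hback] at h'
  exact h'

/-! ### The Liouville theorem, `n ≥ 3` -/

/-- **LIOUVILLE THEOREM for `div(a∇u) = 0`, `n ≥ 3`** (Moser 1961, corollary of Thm 1; Jost, *PDE*, Thm 14.2.3): a bounded
entire `C¹` weak solution is constant.  (Proof: Harnack for `w_ε = (u − inf u + ε)/ε ≥ 1` on `B̄(0,R)`, `R → ∞`, `ε → 0`.)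
[cite: Jost2013PDE, Theorem 14.2.3 p.370 (Liouville; scaling of Moser's Harnack inequality)] -/
theorem liouville_of_three_le (hn : 3 ≤ n) (a : EuclideanSpace ℝ (Fin n) → Matrix (Fin n) (Fin n) ℝ) (lam Λ : ℝ)
    (hlam : 0 < lam) (hmeas : ∀ i j, Measurable fun y => a y i j) (hsymm : ∀ y, (a y).IsSymm)
    (hell : ∀ y (ξ : Fin n → ℝ), lam * (ξ ⬝ᵥ ξ) ≤ ξ ⬝ᵥ (a y *ᵥ ξ)) (hbd : ∀ y i j, |a y i j| ≤ Λ)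
    (u : EuclideanSpace ℝ (Fin n) → ℝ) (hu : ContDiff ℝ 1 u) (hK : ∃ K : ℝ, ∀ y, |u y| ≤ K)
    (hweak : ∀ η : EuclideanSpace ℝ (Fin n) → ℝ, ContDiff ℝ 1 η → HasCompactSupport η →
      ∫ y, ∑ i, ∑ j, a y i j * fderiv ℝ u y (EuclideanSpace.single i 1) *
        fderiv ℝ η y (EuclideanSpace.single j 1) = 0) (x y : EuclideanSpace ℝ (Fin n)) :
    u x = u y := by
  obtain ⟨C_H, hC0, hH⟩ := harnack_ball hn hlam Λ
  obtain ⟨K, hK⟩ := hK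
  have hbdd : BddBelow (range u) := ⟨-K, by rintro _ ⟨z, rfl⟩; exact neg_le_of_abs_le (hK z)⟩
  set m : ℝ := ⨅ z, u z with hm
  have hmle : ∀ z, m ≤ u z := fun z => ciInf_le hbdd z
  -- every value equals the infimum
  suffices key : ∀ z, u z ≤ m by
    exact le_antisymm ((key x).trans (hmle y)) ((key y).trans (hmle x))
  intro z
  by_contra hzm
  rw [not_le] at hzm
  set c : ℝ := u z - m with hc
  have hcpos : 0 < c := by rw [hc]; linarith
  -- ε = δ = c / (4 (C_H + 1))
  set ε : ℝ := c / (4 * (C_H + 1)) with hε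
  have hεpos : 0 < ε := by rw [hε]; positivity
  obtain ⟨z', hz'⟩ : ∃ z', u z' < m + ε := exists_lt_of_ciInf_lt (by rw [← hm]; linarith)
  -- the normalised solution `w = (u - m + ε)/ε ≥ 1`
  set w : EuclideanSpace ℝ (Fin n) → ℝ := fun y => ε⁻¹ * (u y - m + ε) with hw
  have hw1 : ∀ y, 1 ≤ w y := fun y => by
    rw [hw]
    have := hmle y
    rw [le_inv_mul_iff₀' hεpos]; linarith
  have hwC : ContDiff ℝ 1 w := contDiff_const.mul ((hu.sub contDiff_const).add contDiff_const)
  have hdw : ∀ y v, fderiv ℝ w y v = ε⁻¹ * fderiv ℝ u y v := by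
    intro y v
    have hud : DifferentiableAt ℝ u y := (hu.differentiable one_ne_zero) y
    have h1 : fderiv ℝ w y = ε⁻¹ • fderiv ℝ u y := by
      rw [hw, fderiv_const_mul ((hud.sub_const m).add_const ε)]
      rw [fderiv_add_const, fderiv_sub_const]
    rw [h1]; rfl
  have hweak' : ∀ η : EuclideanSpace ℝ (Fin n) → ℝ, ContDiff ℝ 1 η → HasCompactSupport η →
      ∫ y, ∑ i, ∑ j, a y i j * fderiv ℝ w y (EuclideanSpace.single i 1) *
        fderiv ℝ η y (EuclideanSpace.single j 1) = 0 := by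
    intro η hη hηc
    have hpt : ∀ y, ∑ i, ∑ j, a y i j * fderiv ℝ w y (EuclideanSpace.single i 1) *
        fderiv ℝ η y (EuclideanSpace.single j 1) = ε⁻¹ * ∑ i, ∑ j, a y i j * fderiv ℝ u y (EuclideanSpace.single i 1) *
        fderiv ℝ η y (EuclideanSpace.single j 1) := by
      intro y
      simp only [hdw, Finset.mul_sum]
      exact Finset.sum_congr rfl fun i _ => Finset.sum_congr rfl fun j _ => by ring
    simp_rw [hpt]
    rw [integral_const_mul, hweak η hη hηc, mul_zero]
  -- Harnack on a ball containing `z` and `z'`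
  set R : ℝ := max ‖z‖ ‖z'‖ + 1 with hR
  have hRpos : 0 < R := by rw [hR]; positivity
  have hzR : z ∈ closedBall (0 : EuclideanSpace ℝ (Fin n)) R := by
    rw [mem_closedBall, dist_zero_right, hR]; linarith [le_max_left ‖z‖ ‖z'‖]
  have hz'R : z' ∈ closedBall (0 : EuclideanSpace ℝ (Fin n)) R := by
    rw [mem_closedBall, dist_zero_right, hR]; linarith [le_max_right ‖z‖ ‖z'‖]
  have hHz := hH a hmeas hsymm hell hbd w hwC hw1 hweak' 0 R hRpos z hzR z' hz'R
  -- unpack: `u z - m + ε ≤ C_H (u z' - m + ε) < C_H · 2ε`, contradiction with `c = u z - m = 4(C_H+1)ε`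
  simp only [hw] at hHz
  have h1 : u z - m + ε ≤ C_H * (u z' - m + ε) := by
    have := mul_le_mul_of_nonneg_left hHz hεpos.le
    have e1 : ε * (ε⁻¹ * (u z - m + ε)) = u z - m + ε := by field_simp
    have e2 : ε * (C_H * (ε⁻¹ * (u z' - m + ε))) = C_H * (u z' - m + ε) := by field_simp
    rwa [e1, e2] at this
  have h2 : u z' - m + ε < 2 * ε := by linarith
  have h3 : C_H * (u z' - m + ε) ≤ C_H * (2 * ε) := mul_le_mul_of_nonneg_left h2.le hC0
  have h4 : c = 4 * (C_H + 1) * ε := by rw [hε]; field_simp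
  nlinarith

end Literature.Analysis.PDE.DivForm.LiouvilleHigh

end

end Part1

/-!
## Part 2 — port of `Summits/NavierStokesRegularity/NavierStokesRegularity/Theorems/PoloidalWindowDoorPoloidalWindowRigidityDivFormDescent.lean`

# Route `PoloidalWindowDoor`, crux K2 (stmt-NavierStokesRegularity-19708) — task H5, step M4c (part 1): DESCENT of entire
# weak solutions of `div(a∇u) = 0` from `ℝⁿ` to `ℝⁿ⁺¹` (towards `divFormLiouville_holds` in dimensions `n ≤ 2`)

Seat ns-poloidal-K2-p3 g2 (`ledger fact claim` #1 on `Literature.Analysis.PDE.divFormLiouville`).  A solution `u` on `ℝⁿ`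
lifts to `ũ(z) = u(πz)` on `ℝⁿ⁺¹` (`π` = forget the last coordinate), solving `div(ã∇ũ) = 0` with `ã = a ∘ π ⊕ 1`;
hence Liouville in dimension `n+1` implies Liouville in dimension `n`, and the theorem for `n ≥ 3` (M4b) descends to all
`n`.  This file: the linear algebra of `π`, `ι` (re-embedding), the lifted coefficients and their ellipticity/bounds, the
`C¹` lift and its partial derivatives, and the slice test functions `η_t = η̃(ι · + t e_last)`.

* `proj`, `emb` — `π : ℝⁿ⁺¹ →L ℝⁿ`, `ι : ℝⁿ →L ℝⁿ⁺¹` and their coordinates; `emb_proj_add`: `ι(πz) + z_last e_last = z`;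
* `liftCoeff` — `ã`, measurable, symmetric, `min(λ,1)|ξ|² ≤ ξ·ãξ`, `|ãᵢⱼ| ≤ max(Λ,1)`;
* `fderiv_lift_single_castSucc` / `_last` — `∂_{i}ũ = (∂ᵢu)∘π`, `∂_{last}ũ = 0`;
* `sliceTest` — `η_t ∈ C¹_c(ℝⁿ)` and `∂ⱼη_t(πz) = ∂_{j}η̃(z)` at `t = z_last`;
* `lift_integrand_eq` — the lifted weak-form integrand at `z` equals the `n`-dimensional one for `η_{z_last}` at `πz`.

WHAT THIS IS NOT: the Fubini step and the final `divFormLiouville_holds` are in the sequel (M4c part 2); nothing NS-specific.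
-/

section Part2

noncomputable section

open _root_.MeasureTheory _root_.Set _root_.Function _root_.Filter _root_.Topology _root_.Metric _root_.Module
open scoped _root_.Matrix _root_.ENNReal _root_.NNReal

namespace Literature.Analysis.PDE.DivForm.Descent

variable {n : ℕ}

/-! ### Forgetting and restoring the last coordinate -/

/-- `π : ℝⁿ⁺¹ → ℝⁿ`, `(πz)ⱼ = z_{castSucc j}`.
[cite: Jost2013PDE, Theorem 14.2.3 p.370 (proof device: dimension descent)] -/
def proj (n : ℕ) : EuclideanSpace ℝ (Fin (n + 1)) →L[ℝ] EuclideanSpace ℝ (Fin n) :=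
  ∑ j : Fin n, (EuclideanSpace.proj (Fin.castSucc j)).smulRight (EuclideanSpace.single j (1 : ℝ))

/-- `ι : ℝⁿ → ℝⁿ⁺¹`, `(ιx)_{castSucc j} = xⱼ`, `(ιx)_{last} = 0`.
[cite: Jost2013PDE, Theorem 14.2.3 p.370 (proof device: dimension descent)] -/
def emb (n : ℕ) : EuclideanSpace ℝ (Fin n) →L[ℝ] EuclideanSpace ℝ (Fin (n + 1)) :=
  ∑ j : Fin n, (EuclideanSpace.proj j).smulRight (EuclideanSpace.single (Fin.castSucc j) (1 : ℝ))

/-- Coordinates of `π`. [cite: Jost2013PDE, Theorem 14.2.3 p.370 (proof device: dimension descent)] -/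
@[simp] theorem proj_apply (z : EuclideanSpace ℝ (Fin (n + 1))) (j : Fin n) : proj n z j = z (Fin.castSucc j) := by
  simp [proj, WithLp.ofLp_sum, Finset.sum_apply, Pi.single_apply]

/-- Coordinates of `ι` on `castSucc`. [cite: Jost2013PDE, Theorem 14.2.3 p.370 (proof device: dimension descent)] -/
@[simp] theorem emb_apply_castSucc (x : EuclideanSpace ℝ (Fin n)) (j : Fin n) :
    emb n x (Fin.castSucc j) = x j := by
  simp [emb, WithLp.ofLp_sum, Finset.sum_apply, Pi.single_apply]

/-- The last coordinate of `ι x` vanishes.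
[cite: Jost2013PDE, Theorem 14.2.3 p.370 (proof device: dimension descent)] -/
@[simp] theorem emb_apply_last (x : EuclideanSpace ℝ (Fin n)) : emb n x (Fin.last n) = 0 := by
  simp [emb, WithLp.ofLp_sum, Finset.sum_apply, (Fin.castSucc_lt_last _).ne']

/-- `π (ι x) = x`. [cite: Jost2013PDE, Theorem 14.2.3 p.370 (proof device: dimension descent)] -/
@[simp] theorem proj_emb (x : EuclideanSpace ℝ (Fin n)) : proj n (emb n x) = x :=
  PiLp.ext fun j => by simp

/-- `π e_last = 0`. [cite: Jost2013PDE, Theorem 14.2.3 p.370 (proof device: dimension descent)] -/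
@[simp] theorem proj_single_last : proj n (EuclideanSpace.single (Fin.last n) (1 : ℝ)) = 0 :=
  PiLp.ext fun j => by simp [(Fin.castSucc_lt_last j).ne]

/-- `π e_{castSucc i} = e_i`. [cite: Jost2013PDE, Theorem 14.2.3 p.370 (proof device: dimension descent)] -/
@[simp] theorem proj_single_castSucc (i : Fin n) :
    proj n (EuclideanSpace.single (Fin.castSucc i) (1 : ℝ)) = EuclideanSpace.single i 1 :=
  PiLp.ext fun j => by simp [PiLp.single_apply, Fin.castSucc_inj]

/-- `ι e_j = e_{castSucc j}`. [cite: Jost2013PDE, Theorem 14.2.3 p.370 (proof device: dimension descent)] -/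
@[simp] theorem emb_single (j : Fin n) :
    emb n (EuclideanSpace.single j (1 : ℝ)) = EuclideanSpace.single (Fin.castSucc j) 1 := by
  refine PiLp.ext fun I => ?_
  refine Fin.lastCases ?_ (fun i => ?_) I
  · simp [(Fin.castSucc_lt_last j).ne']
  · simp [PiLp.single_apply, Fin.castSucc_inj]

/-- `ι(πz) + z_last e_last = z`. [cite: Jost2013PDE, Theorem 14.2.3 p.370 (proof device: dimension descent)] -/
theorem emb_proj_add (z : EuclideanSpace ℝ (Fin (n + 1))) :
    emb n (proj n z) + z (Fin.last n) • EuclideanSpace.single (Fin.last n) (1 : ℝ) = z := by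
  refine PiLp.ext fun I => ?_
  refine Fin.lastCases ?_ (fun i => ?_) I
  · simp
  · simp [(Fin.castSucc_lt_last i).ne]

/-- The affine slice embedding at height `t`: `J_t x = ι x + t e_last`; `π (J_t x) = x`, `(J_t x)_last = t`.
[cite: Jost2013PDE, Theorem 14.2.3 p.370 (proof device: dimension descent)] -/
theorem proj_slice (t : ℝ) (x : EuclideanSpace ℝ (Fin n)) :
    proj n (emb n x + t • EuclideanSpace.single (Fin.last n) (1 : ℝ)) = x := by
  rw [map_add, map_smul, proj_emb, proj_single_last, smul_zero, add_zero]

/-- `(J_t x)_last = t`. [cite: Jost2013PDE, Theorem 14.2.3 p.370 (proof device: dimension descent)] -/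
theorem slice_last (t : ℝ) (x : EuclideanSpace ℝ (Fin n)) :
    (emb n x + t • EuclideanSpace.single (Fin.last n) (1 : ℝ)) (Fin.last n) = t := by
  simp

/-- `ι` is injective (`π ∘ ι = id`). [cite: Jost2013PDE, Theorem 14.2.3 p.370 (proof device: dimension descent)] -/
theorem emb_injective : Function.Injective (emb n) := fun x y h => by
  have := congrArg (proj n) h
  simpa using this

/-! ### The lifted coefficients `ã = (a ∘ π) ⊕ 1` -/

/-- `ã(z)`: the block matrix `a(πz)` on the `castSucc` indices, `1` at `(last,last)`, `0` elsewhere.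
[cite: Jost2013PDE, Theorem 14.2.3 p.370 (proof device: dimension descent)] -/
def liftCoeff (a : EuclideanSpace ℝ (Fin n) → Matrix (Fin n) (Fin n) ℝ) (z : EuclideanSpace ℝ (Fin (n + 1))) :
    Matrix (Fin (n + 1)) (Fin (n + 1)) ℝ :=
  Matrix.of fun I J => Fin.lastCases (Fin.lastCases (1 : ℝ) (fun _ => 0) J)
    (fun i => Fin.lastCases (0 : ℝ) (fun j => a (proj n z) i j) J) I

/-- The `castSucc`-block of `ã` is `a ∘ π`.
[cite: Jost2013PDE, Theorem 14.2.3 p.370 (proof device: dimension descent)] -/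
@[simp] theorem liftCoeff_castSucc_castSucc (a : EuclideanSpace ℝ (Fin n) → Matrix (Fin n) (Fin n) ℝ)
    (z : EuclideanSpace ℝ (Fin (n + 1))) (i j : Fin n) :
    liftCoeff a z (Fin.castSucc i) (Fin.castSucc j) = a (proj n z) i j := by
  simp [liftCoeff]

/-- The mixed entries of `ã` vanish. [cite: Jost2013PDE, Theorem 14.2.3 p.370 (proof device: dimension descent)] -/
@[simp] theorem liftCoeff_castSucc_last (a : EuclideanSpace ℝ (Fin n) → Matrix (Fin n) (Fin n) ℝ)
    (z : EuclideanSpace ℝ (Fin (n + 1))) (i : Fin n) : liftCoeff a z (Fin.castSucc i) (Fin.last n) = 0 := by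
  simp [liftCoeff]

/-- The mixed entries of `ã` vanish. [cite: Jost2013PDE, Theorem 14.2.3 p.370 (proof device: dimension descent)] -/
@[simp] theorem liftCoeff_last_castSucc (a : EuclideanSpace ℝ (Fin n) → Matrix (Fin n) (Fin n) ℝ)
    (z : EuclideanSpace ℝ (Fin (n + 1))) (j : Fin n) : liftCoeff a z (Fin.last n) (Fin.castSucc j) = 0 := by
  simp [liftCoeff]

/-- The corner entry of `ã` is `1`. [cite: Jost2013PDE, Theorem 14.2.3 p.370 (proof device: dimension descent)] -/
@[simp] theorem liftCoeff_last_last (a : EuclideanSpace ℝ (Fin n) → Matrix (Fin n) (Fin n) ℝ)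
    (z : EuclideanSpace ℝ (Fin (n + 1))) : liftCoeff a z (Fin.last n) (Fin.last n) = 1 := by
  simp [liftCoeff]

variable {a : EuclideanSpace ℝ (Fin n) → Matrix (Fin n) (Fin n) ℝ} {lam Λ : ℝ}

/-- `ã` has measurable entries. [cite: Jost2013PDE, Theorem 14.2.3 p.370 (proof device: dimension descent)] -/
theorem measurable_liftCoeff (hmeas : ∀ i j, Measurable fun y => a y i j) (I J : Fin (n + 1)) :
    Measurable fun z => liftCoeff a z I J := by
  refine Fin.lastCases ?_ (fun i => ?_) I <;> refine Fin.lastCases ?_ (fun j => ?_) J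
  · simp only [liftCoeff_last_last]; exact measurable_const
  · simp only [liftCoeff_last_castSucc]; exact measurable_const
  · simp only [liftCoeff_castSucc_last]; exact measurable_const
  · simp only [liftCoeff_castSucc_castSucc]; exact (hmeas i j).comp (proj n).continuous.measurable

/-- `ã` is symmetric. [cite: Jost2013PDE, Theorem 14.2.3 p.370 (proof device: dimension descent)] -/
theorem isSymm_liftCoeff (hsymm : ∀ y, (a y).IsSymm) (z : EuclideanSpace ℝ (Fin (n + 1))) :
    (liftCoeff a z).IsSymm := by
  refine Matrix.IsSymm.ext fun I J => ?_
  refine Fin.lastCases ?_ (fun i => ?_) I <;> refine Fin.lastCases ?_ (fun j => ?_) J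
  · simp
  · simp
  · simp
  · simp only [liftCoeff_castSucc_castSucc]; exact (hsymm _).apply i j

/-- `ã` is uniformly elliptic with constant `min λ 1`.
[cite: Jost2013PDE, Theorem 14.2.3 p.370 (proof device: dimension descent)] -/
theorem liftCoeff_elliptic (hell : ∀ y (ξ : Fin n → ℝ), lam * (ξ ⬝ᵥ ξ) ≤ ξ ⬝ᵥ (a y *ᵥ ξ))
    (z : EuclideanSpace ℝ (Fin (n + 1))) (ξ : Fin (n + 1) → ℝ) :
    min lam 1 * (ξ ⬝ᵥ ξ) ≤ ξ ⬝ᵥ (liftCoeff a z *ᵥ ξ) := by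
  have h := hell (proj n z) (fun i => ξ (Fin.castSucc i))
  simp only [dotProduct, Matrix.mulVec] at h ⊢
  simp only [Fin.sum_univ_castSucc, liftCoeff_castSucc_castSucc, liftCoeff_castSucc_last, liftCoeff_last_castSucc,
    liftCoeff_last_last, zero_mul, add_zero, Finset.sum_const_zero, zero_add, one_mul]
  have hS : 0 ≤ ∑ i : Fin n, ξ (Fin.castSucc i) * ξ (Fin.castSucc i) :=
    Finset.sum_nonneg fun i _ => mul_self_nonneg _
  have ht : 0 ≤ ξ (Fin.last n) * ξ (Fin.last n) := mul_self_nonneg _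
  have hm1 : min lam 1 ≤ lam := min_le_left _ _
  have hm2 : min lam 1 ≤ 1 := min_le_right _ _
  nlinarith

/-- `|ãᵢⱼ| ≤ max Λ 1`. [cite: Jost2013PDE, Theorem 14.2.3 p.370 (proof device: dimension descent)] -/
theorem abs_liftCoeff_le (hbd : ∀ y i j, |a y i j| ≤ Λ) (z : EuclideanSpace ℝ (Fin (n + 1))) (I J : Fin (n + 1)) :
    |liftCoeff a z I J| ≤ max Λ 1 := by
  refine Fin.lastCases ?_ (fun i => ?_) I <;> refine Fin.lastCases ?_ (fun j => ?_) J
  · simp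
  · simp
  · simp
  · simp only [liftCoeff_castSucc_castSucc]; exact (hbd _ i j).trans (le_max_left _ _)

/-! ### The lifted solution `ũ = u ∘ π` and the slice test functions -/

variable {u : EuclideanSpace ℝ (Fin n) → ℝ}

/-- `ũ ∈ C¹`. [cite: Jost2013PDE, Theorem 14.2.3 p.370 (proof device: dimension descent)] -/
theorem contDiff_lift (hu : ContDiff ℝ 1 u) : ContDiff ℝ 1 fun z => u (proj n z) := hu.comp (proj n).contDiff

/-- Partial derivatives of `ũ`: `∂_I ũ(z) = Du(πz)[π e_I]`.
[cite: Jost2013PDE, Theorem 14.2.3 p.370 (proof device: dimension descent)] -/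
theorem fderiv_lift (hu : ContDiff ℝ 1 u) (z : EuclideanSpace ℝ (Fin (n + 1))) (v : EuclideanSpace ℝ (Fin (n + 1))) :
    fderiv ℝ (fun z => u (proj n z)) z v = fderiv ℝ u (proj n z) (proj n v) := by
  have h := (((hu.differentiable one_ne_zero) (proj n z)).hasFDerivAt).comp z (proj n).hasFDerivAt
  rw [show (fun z => u (proj n z)) = u ∘ proj n from rfl, h.fderiv]
  rfl

/-- The slice test function `η_t(x) = η̃(ιx + t e_last)` is `C¹`…
[cite: Jost2013PDE, Theorem 14.2.3 p.370 (proof device: dimension descent)] -/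
theorem contDiff_slice {η : EuclideanSpace ℝ (Fin (n + 1)) → ℝ} (hη : ContDiff ℝ 1 η) (t : ℝ) :
    ContDiff ℝ 1 fun x => η (emb n x + t • EuclideanSpace.single (Fin.last n) (1 : ℝ)) :=
  hη.comp ((emb n).contDiff.add contDiff_const)

/-- … and compactly supported. [cite: Jost2013PDE, Theorem 14.2.3 p.370 (proof device: dimension descent)] -/
theorem hasCompactSupport_slice {η : EuclideanSpace ℝ (Fin (n + 1)) → ℝ} (hηc : HasCompactSupport η) (t : ℝ) :
    HasCompactSupport fun x => η (emb n x + t • EuclideanSpace.single (Fin.last n) (1 : ℝ)) := by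
  have hemb : IsClosedEmbedding (emb n) := by
    have hker : LinearMap.ker ((emb n : EuclideanSpace ℝ (Fin n) →L[ℝ] EuclideanSpace ℝ (Fin (n + 1))) :
        EuclideanSpace ℝ (Fin n) →ₗ[ℝ] EuclideanSpace ℝ (Fin (n + 1))) = ⊥ :=
      LinearMap.ker_eq_bot.2 (emb_injective (n := n))
    exact LinearMap.isClosedEmbedding_of_injective hker
  have hg : IsClosedEmbedding fun x => emb n x + t • EuclideanSpace.single (Fin.last n) (1 : ℝ) :=
    (Homeomorph.addRight (t • EuclideanSpace.single (Fin.last n) (1 : ℝ))).isClosedEmbedding.comp hemb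
  exact hηc.comp_isClosedEmbedding hg

/-- Partial derivatives of the slice: `∂ⱼη_t(x) = ∂_{castSucc j} η̃(ιx + t e_last)`.
[cite: Jost2013PDE, Theorem 14.2.3 p.370 (proof device: dimension descent)] -/
theorem fderiv_slice {η : EuclideanSpace ℝ (Fin (n + 1)) → ℝ} (hη : ContDiff ℝ 1 η) (t : ℝ)
    (x : EuclideanSpace ℝ (Fin n)) (j : Fin n) :
    fderiv ℝ (fun x => η (emb n x + t • EuclideanSpace.single (Fin.last n) (1 : ℝ))) x (EuclideanSpace.single j 1) =
      fderiv ℝ η (emb n x + t • EuclideanSpace.single (Fin.last n) (1 : ℝ)) (EuclideanSpace.single (Fin.castSucc j) 1) := by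
  have hg : HasFDerivAt (fun x => emb n x + t • EuclideanSpace.single (Fin.last n) (1 : ℝ)) (emb n) x :=
    (emb n).hasFDerivAt.add_const _
  have h := (((hη.differentiable one_ne_zero) _).hasFDerivAt).comp x hg
  rw [show (fun x => η (emb n x + t • EuclideanSpace.single (Fin.last n) (1 : ℝ))) =
    η ∘ fun x => emb n x + t • EuclideanSpace.single (Fin.last n) (1 : ℝ) from rfl, h.fderiv]
  simp

/-- **The lifted weak-form integrand equals the `n`-dimensional one on the slice through `z`.**
[cite: Jost2013PDE, Theorem 14.2.3 p.370 (proof device: dimension descent)] -/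
theorem lift_integrand_eq (hu : ContDiff ℝ 1 u) {η : EuclideanSpace ℝ (Fin (n + 1)) → ℝ} (hη : ContDiff ℝ 1 η)
    (z : EuclideanSpace ℝ (Fin (n + 1))) :
    ∑ I, ∑ J, liftCoeff a z I J * fderiv ℝ (fun z => u (proj n z)) z (EuclideanSpace.single I 1) *
        fderiv ℝ η z (EuclideanSpace.single J 1) =
      ∑ i, ∑ j, a (proj n z) i j * fderiv ℝ u (proj n z) (EuclideanSpace.single i 1) *
        fderiv ℝ (fun x => η (emb n x + z (Fin.last n) • EuclideanSpace.single (Fin.last n) (1 : ℝ))) (proj n z)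
          (EuclideanSpace.single j 1) := by
  simp only [fderiv_lift hu, fderiv_slice hη, emb_proj_add, Fin.sum_univ_castSucc, proj_single_castSucc,
    proj_single_last, map_zero, liftCoeff_castSucc_castSucc, liftCoeff_castSucc_last, liftCoeff_last_castSucc,
    liftCoeff_last_last, zero_mul, mul_zero, add_zero, Finset.sum_const_zero]

end Literature.Analysis.PDE.DivForm.Descent

end

end Part2

/-!
## Part 3 — port of `Summits/NavierStokesRegularity/NavierStokesRegularity/Theorems/PoloidalWindowDoorPoloidalWindowRigidityDivFormLiouvilleAll.lean`

# Route `PoloidalWindowDoor`, crux K2 (stmt-NavierStokesRegularity-19708) — task H5, step M4c (part 2): the weak equation of the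
# lifted solution (Fubini), DESCENT of the Liouville property, and the LIOUVILLE THEOREM IN EVERY DIMENSION

Seat ns-poloidal-K2-p3 g2 (`ledger fact claim` #1 on `Literature.Analysis.PDE.divFormLiouville`).

* `lift_weak` — if `u` is an entire `C¹` weak solution for `a` on `ℝⁿ`, then `ũ = u ∘ π` is one for `ã` on `ℝⁿ⁺¹`
  (Fubini over the last coordinate: each slice gives the `n`-dimensional weak equation with the test function `η_t`);
* `liouville_descent` — Liouville in dimension `n+1` (for all ellipticity constants) implies Liouville in dimension `n`;
* `liouville_all` — **every bounded entire `C¹` weak solution of `div(a∇u) = 0`, `a` measurable symmetric with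
  `λ|ξ|² ≤ ξ·aξ`, `|aᵢⱼ| ≤ Λ`, is constant, in every dimension `n`** — the statement of the named fact
  `Literature.Analysis.PDE.divFormLiouville` (its Literature-side discharge `divFormLiouville_holds` is a one-liner from here).

WHAT THIS IS NOT: nothing Navier–Stokes-specific; the NS consumer is the K2 lead's M11 (`…EllipticSlope`, p482138).
-/

section Part3

noncomputable section

open _root_.MeasureTheory _root_.Set _root_.Function _root_.Filter _root_.Topology _root_.Metric _root_.Module
open scoped _root_.Matrix _root_.ENNReal _root_.NNReal

namespace Literature.Analysis.PDE.DivForm.LiouvilleAll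

open Literature.Analysis.PDE.DivForm.Caccioppoli
open Literature.Analysis.PDE.DivForm.Descent
open Literature.Analysis.PDE.DivForm.LiouvilleHigh

variable {n : ℕ}

/-! ### The lifted weak equation -/

variable {a : EuclideanSpace ℝ (Fin n) → Matrix (Fin n) (Fin n) ℝ} {Λ : ℝ} {u : EuclideanSpace ℝ (Fin n) → ℝ}

/-- **The lift `ũ = u ∘ π` is a weak solution for `ã`.**
[cite: Jost2013PDE, Theorem 14.2.3 p.370 (Liouville in every dimension)] -/
theorem lift_weak (hmeas : ∀ i j, Measurable fun y => a y i j) (hbd : ∀ y i j, |a y i j| ≤ Λ)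
    (hu : ContDiff ℝ 1 u)
    (hweak : ∀ η : EuclideanSpace ℝ (Fin n) → ℝ, ContDiff ℝ 1 η → HasCompactSupport η →
      ∫ y, ∑ i, ∑ j, a y i j * fderiv ℝ u y (EuclideanSpace.single i 1) *
        fderiv ℝ η y (EuclideanSpace.single j 1) = 0)
    (η : EuclideanSpace ℝ (Fin (n + 1)) → ℝ) (hη : ContDiff ℝ 1 η) (hηc : HasCompactSupport η) :
    ∫ z, ∑ I, ∑ J, liftCoeff a z I J * fderiv ℝ (fun z => u (proj n z)) z (EuclideanSpace.single I 1) *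
      fderiv ℝ η z (EuclideanSpace.single J 1) = 0 := by
  -- the slice integrand `G0 t x = Σ aᵢⱼ(x) ∂ᵢu(x) ∂ⱼη_t(x)`
  set e1 : EuclideanSpace ℝ (Fin (n + 1)) := EuclideanSpace.single (Fin.last n) (1 : ℝ) with he1
  set G0 : ℝ → EuclideanSpace ℝ (Fin n) → ℝ := fun t x => ∑ i, ∑ j, a x i j *
    fderiv ℝ u x (EuclideanSpace.single i 1) *
      fderiv ℝ (fun x => η (emb n x + t • e1)) x (EuclideanSpace.single j 1) with hG0
  have hslice0 : ∀ t, ∫ x, G0 t x = 0 := fun t =>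
    hweak _ (contDiff_slice hη t) (hasCompactSupport_slice hηc t)
  -- rewrite the lifted integrand as `G0 (z_last) (π z)`
  have hpt : ∀ z, ∑ I, ∑ J, liftCoeff a z I J * fderiv ℝ (fun z => u (proj n z)) z (EuclideanSpace.single I 1) *
      fderiv ℝ η z (EuclideanSpace.single J 1) = G0 (z (Fin.last n)) (proj n z) := fun z => by
    rw [lift_integrand_eq hu hη z]
  simp_rw [hpt]
  -- integrability of `z ↦ G0 (z_last) (πz)` on `ℝⁿ⁺¹`: undo the rewrite and bound term by term
  have hInt : Integrable fun z : EuclideanSpace ℝ (Fin (n + 1)) => G0 (z (Fin.last n)) (proj n z) := by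
    have heq : (fun z : EuclideanSpace ℝ (Fin (n + 1)) => G0 (z (Fin.last n)) (proj n z)) = fun z =>
        ∑ I, ∑ J, liftCoeff a z I J * fderiv ℝ (fun z => u (proj n z)) z (EuclideanSpace.single I 1) *
          fderiv ℝ η z (EuclideanSpace.single J 1) := by
      funext z; rw [hpt z]
    rw [heq]
    refine integrable_finsetSum _ fun I _ => integrable_finsetSum _ fun J _ => ?_
    have hcu := continuous_fderiv_single (contDiff_lift (n := n) hu) I
    have hcη := continuous_fderiv_single hη J
    have h := integrable_mul_of_le_continuous (n := n + 1)
      (m := fun z => liftCoeff a z I J * fderiv ℝ (fun z => u (proj n z)) z (EuclideanSpace.single I 1))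
      (M := fun z => max Λ 1 * |fderiv ℝ (fun z => u (proj n z)) z (EuclideanSpace.single I 1)|)
      (φ := fun z => fderiv ℝ η z (EuclideanSpace.single J 1))
      ((measurable_liftCoeff hmeas I J).mul hcu.measurable) (continuous_const.mul hcu.abs)
      (fun z => by rw [abs_mul]; exact mul_le_mul_of_nonneg_right (abs_liftCoeff_le hbd z I J) (abs_nonneg _))
      hcη ?_
    · exact h
    · have h0 : HasCompactSupport (fderiv ℝ η) := hηc.fderiv (𝕜 := ℝ)
      exact h0.mono (Function.support_subset_iff'.2 fun z hz => by
        simp only [Function.mem_support, not_not] at hz; simp [hz])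
  -- (1) to `Fin (n+1) → ℝ`
  set g : (Fin (n + 1) → ℝ) → ℝ := fun f => G0 (f (Fin.last n)) (WithLp.toLp 2 fun j => f (Fin.castSucc j)) with hg
  have hproj : ∀ z : EuclideanSpace ℝ (Fin (n + 1)), proj n z = WithLp.toLp 2 (fun j => z (Fin.castSucc j)) := fun z =>
    PiLp.ext fun j => by simp
  have hGg : (fun z : EuclideanSpace ℝ (Fin (n + 1)) => G0 (z (Fin.last n)) (proj n z)) = g ∘ WithLp.ofLp := by
    funext z; simp only [Function.comp_apply, hg, hproj]
  have hmp1 : MeasurePreserving (MeasurableEquiv.toLp 2 (Fin (n + 1) → ℝ)).symm := by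
    simpa [MeasurableEquiv.coe_toLp_symm] using PiLp.volume_preserving_ofLp (Fin (n + 1))
  have h1 : ∫ z : EuclideanSpace ℝ (Fin (n + 1)), G0 (z (Fin.last n)) (proj n z) = ∫ f : Fin (n + 1) → ℝ, g f := by
    rw [hGg]
    exact hmp1.integral_comp' g
  have hIg : Integrable g := by
    have h := (hmp1.integrable_comp_emb (MeasurableEquiv.toLp 2 (Fin (n + 1) → ℝ)).symm.measurableEmbedding (g := g)).1
    apply h
    rw [MeasurableEquiv.coe_toLp_symm, ← hGg]
    exact hInt
  -- (2) split the last coordinate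
  set e := MeasurableEquiv.piFinSuccAbove (fun _ : Fin (n + 1) => ℝ) (Fin.last n) with he
  have hmp2 : MeasurePreserving e.symm := (volume_preserving_piFinSuccAbove (fun _ : Fin (n + 1) => ℝ) (Fin.last n)).symm _
  have hge : ∀ p : ℝ × (Fin n → ℝ), g (e.symm p) = G0 p.1 (WithLp.toLp 2 p.2) := by
    rintro ⟨t, x⟩
    simp only [hg, he, MeasurableEquiv.piFinSuccAbove, MeasurableEquiv.symm_mk, MeasurableEquiv.coe_mk,
      Equiv.symm_symm, Fin.insertNthEquiv, Equiv.coe_fn_mk, Fin.insertNth_last', Fin.snoc_last]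
    congr 2
    funext j
    rw [Fin.snoc_castSucc]
  have h2 : ∫ f : Fin (n + 1) → ℝ, g f = ∫ p : ℝ × (Fin n → ℝ), G0 p.1 (WithLp.toLp 2 p.2) := by
    rw [← hmp2.integral_comp' g]
    exact integral_congr_ae (Eventually.of_forall hge)
  have hIp : Integrable fun p : ℝ × (Fin n → ℝ) => G0 p.1 (WithLp.toLp 2 p.2) := by
    have h := (hmp2.integrable_comp_emb e.symm.measurableEmbedding (g := g)).2 hIg
    exact h.congr (Eventually.of_forall hge)
  -- (3) Fubini and the slices
  have hmp3 : MeasurePreserving (MeasurableEquiv.toLp 2 (Fin n → ℝ)) := by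
    simpa [MeasurableEquiv.coe_toLp] using PiLp.volume_preserving_toLp (Fin n)
  have h3 : ∫ p : ℝ × (Fin n → ℝ), G0 p.1 (WithLp.toLp 2 p.2) = ∫ t : ℝ, ∫ x : Fin n → ℝ, G0 t (WithLp.toLp 2 x) := by
    rw [← integral_prod _ hIp]; rfl
  have h4 : ∀ t : ℝ, ∫ x : Fin n → ℝ, G0 t (WithLp.toLp 2 x) = 0 := by
    intro t
    have h := hmp3.integral_comp' (G0 t)
    rw [MeasurableEquiv.coe_toLp] at h
    rw [h]
    exact hslice0 t
  rw [h1, h2, h3]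
  simp_rw [h4]
  simp

/-! ### Descent of the Liouville property and the theorem in every dimension -/

/-- **Descent.**  If the Liouville theorem holds in dimension `n+1` (for all measurable symmetric uniformly elliptic
bounded coefficient fields and all ellipticity constants), it holds in dimension `n`: apply it to `ũ = u ∘ π`, `ã`.
[cite: Jost2013PDE, Theorem 14.2.3 p.370 (Liouville in every dimension)] -/
theorem liouville_descent
    (hN : ∀ (a : EuclideanSpace ℝ (Fin (n + 1)) → Matrix (Fin (n + 1)) (Fin (n + 1)) ℝ) (lam Λ : ℝ), 0 < lam →
      (∀ i j, Measurable fun y => a y i j) → (∀ y, (a y).IsSymm) →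
      (∀ y (ξ : Fin (n + 1) → ℝ), lam * (ξ ⬝ᵥ ξ) ≤ ξ ⬝ᵥ (a y *ᵥ ξ)) → (∀ y i j, |a y i j| ≤ Λ) →
      ∀ (u : EuclideanSpace ℝ (Fin (n + 1)) → ℝ), ContDiff ℝ 1 u → (∃ K : ℝ, ∀ y, |u y| ≤ K) →
        (∀ η : EuclideanSpace ℝ (Fin (n + 1)) → ℝ, ContDiff ℝ 1 η → HasCompactSupport η →
          ∫ y, ∑ i, ∑ j, a y i j * fderiv ℝ u y (EuclideanSpace.single i 1) *
            fderiv ℝ η y (EuclideanSpace.single j 1) = 0) →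
        ∀ x y, u x = u y)
    (a : EuclideanSpace ℝ (Fin n) → Matrix (Fin n) (Fin n) ℝ) (lam Λ : ℝ) (hlam : 0 < lam)
    (hmeas : ∀ i j, Measurable fun y => a y i j) (hsymm : ∀ y, (a y).IsSymm)
    (hell : ∀ y (ξ : Fin n → ℝ), lam * (ξ ⬝ᵥ ξ) ≤ ξ ⬝ᵥ (a y *ᵥ ξ)) (hbd : ∀ y i j, |a y i j| ≤ Λ)
    (u : EuclideanSpace ℝ (Fin n) → ℝ) (hu : ContDiff ℝ 1 u) (hK : ∃ K : ℝ, ∀ y, |u y| ≤ K)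
    (hweak : ∀ η : EuclideanSpace ℝ (Fin n) → ℝ, ContDiff ℝ 1 η → HasCompactSupport η →
      ∫ y, ∑ i, ∑ j, a y i j * fderiv ℝ u y (EuclideanSpace.single i 1) *
        fderiv ℝ η y (EuclideanSpace.single j 1) = 0) (x y : EuclideanSpace ℝ (Fin n)) :
    u x = u y := by
  obtain ⟨K, hK⟩ := hK
  have h := hN (liftCoeff a) (min lam 1) (max Λ 1) (lt_min hlam one_pos) (measurable_liftCoeff hmeas)
    (isSymm_liftCoeff hsymm) (liftCoeff_elliptic hell) (abs_liftCoeff_le hbd) (fun z => u (proj n z))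
    (contDiff_lift hu) ⟨K, fun z => hK _⟩ (lift_weak hmeas hbd hu hweak) (emb n x) (emb n y)
  simpa using h

/-- **LIOUVILLE THEOREM for `div(a∇u) = 0` in every dimension** (De Giorgi–Nash–Moser; Moser 1961, corollary of Thm 1;
Jost, *PDE*, Thm 14.2.3): for `a` measurable, symmetric, `λ|ξ|² ≤ ξ·aξ` (`λ > 0`), `|aᵢⱼ| ≤ Λ`, every bounded
`u ∈ C¹(ℝⁿ)` with `∫ Σ aᵢⱼ ∂ᵢu ∂ⱼη = 0` for all `η ∈ C¹_c` is constant.  (`n ≥ 3`: Moser's Harnack inequality, M4b;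
`n ≤ 2`: descent from `n + 1`.) [cite: Jost2013PDE, Theorem 14.2.3 p.370 (Liouville in every dimension)] -/
theorem liouville_all (n : ℕ) (a : EuclideanSpace ℝ (Fin n) → Matrix (Fin n) (Fin n) ℝ) (lam Λ : ℝ)
    (hlam : 0 < lam) (hmeas : ∀ i j, Measurable fun y => a y i j) (hsymm : ∀ y, (a y).IsSymm)
    (hell : ∀ y (ξ : Fin n → ℝ), lam * (ξ ⬝ᵥ ξ) ≤ ξ ⬝ᵥ (a y *ᵥ ξ)) (hbd : ∀ y i j, |a y i j| ≤ Λ)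
    (u : EuclideanSpace ℝ (Fin n) → ℝ) (hu : ContDiff ℝ 1 u) (hK : ∃ K : ℝ, ∀ y, |u y| ≤ K)
    (hweak : ∀ η : EuclideanSpace ℝ (Fin n) → ℝ, ContDiff ℝ 1 η → HasCompactSupport η →
      ∫ y, ∑ i, ∑ j, a y i j * fderiv ℝ u y (EuclideanSpace.single i 1) *
        fderiv ℝ η y (EuclideanSpace.single j 1) = 0) (x y : EuclideanSpace ℝ (Fin n)) :
    u x = u y := by
  -- `P m`: the Liouville property in dimension `m`
  let P : ℕ → Prop := fun m => ∀ (a : EuclideanSpace ℝ (Fin m) → Matrix (Fin m) (Fin m) ℝ) (lam Λ : ℝ), 0 < lam →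
      (∀ i j, Measurable fun y => a y i j) → (∀ y, (a y).IsSymm) →
      (∀ y (ξ : Fin m → ℝ), lam * (ξ ⬝ᵥ ξ) ≤ ξ ⬝ᵥ (a y *ᵥ ξ)) → (∀ y i j, |a y i j| ≤ Λ) →
      ∀ (u : EuclideanSpace ℝ (Fin m) → ℝ), ContDiff ℝ 1 u → (∃ K : ℝ, ∀ y, |u y| ≤ K) →
        (∀ η : EuclideanSpace ℝ (Fin m) → ℝ, ContDiff ℝ 1 η → HasCompactSupport η →
          ∫ y, ∑ i, ∑ j, a y i j * fderiv ℝ u y (EuclideanSpace.single i 1) *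
            fderiv ℝ η y (EuclideanSpace.single j 1) = 0) →
        ∀ x y, u x = u y
  have hP : ∀ k m : ℕ, 3 ≤ m + k → P m := by
    intro k
    induction k with
    | zero => intro m hm; exact fun a lam Λ hlam hmeas hsymm hell hbd u hu hK hweak x y =>
        liouville_of_three_le (by omega) a lam Λ hlam hmeas hsymm hell hbd u hu hK hweak x y
    | succ k ih => intro m hm; exact fun a lam Λ hlam hmeas hsymm hell hbd u hu hK hweak x y =>
        liouville_descent (ih (m + 1) (by omega)) a lam Λ hlam hmeas hsymm hell hbd u hu hK hweak x y
  exact hP 3 n (by omega) a lam Λ hlam hmeas hsymm hell hbd u hu hK hweak x y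

/-- **Discharge of the named fact `Literature.Analysis.PDE.divFormLiouville`** (De Giorgi–Nash–Moser Liouville theorem;
Jost, *PDE*, Thm 14.2.3; Moser 1961, Thm 1 and corollary).  Proved in the tree by the chain
`…DivFormCaccioppoli` → `…CaccioppoliPowers` → `…LogBMO` → `…Crossover` → `…ReverseHolder` → `…MoserStep` → `…MoserChain`
→ `…Harnack` → `…LiouvilleHigh` → `…Descent` → this file (seat ns-poloidal-K2-p3 g2, `ledger fact claim` #1).
[cite: Jost2013PDE, Thm 14.2.3 (p. 370)] [cite: Moser1961Harnack, Thm 1] -/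
theorem _root_.Literature.Analysis.PDE.DivForm.divFormLiouville_holds : Literature.Analysis.PDE.divFormLiouville :=
  fun n a lam Λ hlam hmeas hsymm hell hbd u hu hK hweak x y =>
    liouville_all n a lam Λ hlam hmeas hsymm hell hbd u hu hK hweak x y

end Literature.Analysis.PDE.DivForm.LiouvilleAll

end

end Part3

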